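import Literature.NumberTheory.Sieve.GoldbachLinnikDirectMinorArcs
import Literature.NumberTheory.Sieve.GoldbachLinnikDirectSeven
import Literature.NumberTheory.Sieve.MontgomeryVaughan1975MinorArcs
import HarnessLib

/-!
# The log-weighted Goldbach major-arc integral on the periodised Montgomery–Vaughan arcs versus
Montgomery–Vaughan's `R₁(n)`, PROVED

Topic `Literature/NumberTheory/Sieve`, namespace `Literature.NumberTheory.Sieve.GoldbachLinnik`
(continuation of `GoldbachLinnikDirectRoute.lean` — `A_N(α) = ∑_{2<p≤N} (log p) e(pα)` =
`oddPrimeLogSum`, `R^G_𝔐(N; n) = Re ∫_{[0,1]∩𝔐} A_N² e(−nα)` = `majorArcGoldbachIntegral` — of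
`GoldbachLinnikAssembly.lean` — the periodised arcs `periodicArcs P Q = 𝔐 ∪ (𝔐 − 1)` of the
Montgomery–Vaughan/Pintz–Ruzsa major arcs `MontgomeryVaughan1975.majorArcs P Q ⊆ (1/Q, 1 + 1/Q]`
and the de-periodisation `setIntegral_inter_periodicArcs_eq` — and of `MontgomeryVaughan1975.lean`
— `S(α) = ∑_{P<p≤X} (log p) e(pα)` = `expSum`, `R₁(n) = ∫_𝔐 S² e(−nα)` = `majorArcIntegral`
[MontgomeryVaughanActa1975, (2.2), (3.1)]).

Heath-Brown–Puchta's frame for Linnik's problem [HeathbrownPuchta2002, §4 (16)–(20), §6] reads the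
major arcs on `[0,1]` with the full odd-prime sum `A_N`, whereas Montgomery–Vaughan's major-arc
formulae [MontgomeryVaughanActa1975, (6.17), (6.1͂7)] are stated for `R₁(n)` with the window
`P < p ≤ X` on `α ∈ [1/Q, 1 + 1/Q]`.  The two differ by (a) the periodisation (exact, for the
`1`-periodic integrand) and (b) the primes `p ≤ P`: `‖A_N − S‖ ≤ θ(P) + log 2`, so
`|R^G_{𝔐̃}(N; n) − Re R₁(n)| ≤ |[0,1] ∩ 𝔐̃| · (θ(P) + log 2) · 2θ(N) ≤ (4P/Q)(θ(P) + log 2)·2θ(N)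
≤ 48 P² N/Q` (`|𝔐| ≤ 2P/Q`).  At Montgomery–Vaughan's level `P = N^{6δ}`, `Q = N^{1−6δ}` this is
`≤ 48 N^{18δ} = o(N)` for `δ < 1/18` — the «passage from MV's `S` to `A_N`» of the parity-ideate
route `LinnikGallagherMV` (crux «PointwiseMajorArcsMV», piece `stub_pointwise_of`).  No new facts.
Written for the parity-ideate cell (literature seat g16, 2026-08-27).

* `MontgomeryVaughan1975.expSum_add_one`, `MontgomeryVaughan1975.norm_expSum_le_theta` — period `1`
  and the trivial bound `‖S(α)‖ ≤ θ(X)`.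
* `norm_oddPrimeLogSum_sub_expSum_le` — `‖A_N(α) − S_{P,N}(α)‖ ≤ θ(P) + log 2`.
* `MontgomeryVaughan1975.volume_majorArcs_le` — `|𝔐(P, Q)| ≤ 2P/Q`;
  `volume_real_inter_periodicArcs_le` — `|[0,1] ∩ periodicArcs P Q| ≤ 4P/Q`.
* `abs_majorArcGoldbachIntegral_periodicArcs_sub_re_le` (θ-form) and `…_le'` (`≤ 48 P² N/Q`).

## References

* [HeathbrownPuchta2002] D. R. Heath-Brown, J.-C. Puchta, *Integers represented as a sum of primes
  and powers of two*, Asian J. Math. 6 (2002) 535–565, §4 (16)–(20), §6.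
* [MontgomeryVaughanActa1975] H. L. Montgomery, R. C. Vaughan, *The exceptional set in Goldbach's
  problem*, Acta Arith. 27 (1975) 353–370, §2 (2.2)–(2.4), §3 (3.1).
* [PintzRuzsa2003] J. Pintz, I. Z. Ruzsa, *On Linnik's approximation to Goldbach's problem, I*,
  Acta Arith. 109 (2003) 169–194, (2.2)–(2.4).

## Mathlib / tree search

Tree: `periodicArcs`, `mem_periodicArcs`, `measurableSet_periodicArcs`,
`setIntegral_inter_periodicArcs_eq` (`GoldbachLinnikAssembly`); `oddPrimeLogSum_add_one`,
`norm_oddPrimeLogSum_le_theta`, `oddPrimes_eq_filter` (`GoldbachLinnikMinorArcs`,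
`GoldbachLinnikDirectMinorArcs`); `MontgomeryVaughan1975.norm_primeExpSumLog_sub_expSum_le`,
`continuous_expSum_sq_mul`, `measurableSet_majorArcs`. Mathlib: `measure_biUnion_finset_le`,
`Real.volume_Icc`, `measure_preimage_add_right`, `norm_setIntegral_le_of_norm_le_const`,
`Chebyshev.theta_le_log4_mul_x`. `lean search 'volume_majorArcs_le|sub_expSum_le|periodicArcs_sub_re'`:
nothing before this file.
-/

noncomputable section

open scoped FourierTransform

open Finset Filter MeasureTheory

namespace Literature.NumberTheory.Sieve

namespace MontgomeryVaughan1975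

/-- `S(α + 1) = S(α)`: Montgomery–Vaughan's prime-window sum has period `1` (integer frequencies).
[cite: MontgomeryVaughanActa1975, §2 (2.2)] -/
theorem expSum_add_one (P X α : ℝ) : expSum P X (α + 1) = expSum P X α := by
  unfold expSum
  refine Finset.sum_congr rfl fun p _ => ?_
  have h1 : (𝐞 ((p : ℕ) : ℝ) : ℂ) = 1 := by
    rw [← Int.cast_natCast (R := ℝ) p, Real.fourierChar_apply', Circle.exp_two_pi_mul_int,
      Circle.coe_one]
  rw [mul_add, mul_one, GoldbachLinnik.fourierChar_add_coe, h1, mul_one]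

/-- The trivial bound `‖S(α)‖ ≤ ∑_{P<p≤X} log p ≤ θ(X)`. [cite: MontgomeryVaughanActa1975, §2 (2.2)] -/
theorem norm_expSum_le_theta (P X α : ℝ) : ‖expSum P X α‖ ≤ Chebyshev.theta X := by
  rw [Chebyshev.theta_eq_sum_primesLE, expSum, primeWindow]
  refine (norm_sum_le _ _).trans ?_
  calc ∑ p ∈ (Nat.primesLE ⌊X⌋₊).filter (fun p : ℕ => P < p), ‖(Real.log p : ℂ) * (𝐞 (p * α) : ℂ)‖
      = ∑ p ∈ (Nat.primesLE ⌊X⌋₊).filter (fun p : ℕ => P < p), Real.log p := by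
        refine Finset.sum_congr rfl fun p _ => ?_
        rw [norm_mul, Circle.norm_coe, mul_one, Complex.norm_real,
          Real.norm_of_nonneg (Real.log_natCast_nonneg p)]
    _ ≤ ∑ p ∈ Nat.primesLE ⌊X⌋₊, Real.log p :=
        Finset.sum_le_sum_of_subset_of_nonneg (Finset.filter_subset _ _)
          fun p _ _ => Real.log_natCast_nonneg p

/-- **`|𝔐(P, Q)| ≤ 2P/Q`**: the major arcs are `∑_{q≤P} φ(q) ≤ P·q` intervals of length `2/(qQ)`
(Montgomery–Vaughan 1975, §2 after (2.4)). [cite: MontgomeryVaughanActa1975, §2 (2.4)] -/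
theorem volume_majorArcs_le {P Q : ℝ} (hP : 0 ≤ P) (hQ : 0 < Q) :
    volume (majorArcs P Q) ≤ ENNReal.ofReal (2 * P / Q) := by
  unfold majorArcs
  have hq_sum : ∀ q ∈ Finset.Icc 1 ⌊P⌋₊,
      volume (⋃ a ∈ (Finset.Icc 1 q).filter (fun a => a.Coprime q), majorArc Q q a) ≤
        ENNReal.ofReal (2 / Q) := by
    intro q hq
    have hq1 : 1 ≤ q := (Finset.mem_Icc.mp hq).1
    have hq0 : (0 : ℝ) < q := by exact_mod_cast hq1
    calc volume (⋃ a ∈ (Finset.Icc 1 q).filter (fun a => a.Coprime q), majorArc Q q a)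
        ≤ ∑ a ∈ (Finset.Icc 1 q).filter (fun a => a.Coprime q), volume (majorArc Q q a) :=
          measure_biUnion_finset_le _ _
      _ = ∑ a ∈ (Finset.Icc 1 q).filter (fun a => a.Coprime q), ENNReal.ofReal (2 / (q * Q)) := by
          refine Finset.sum_congr rfl fun a _ => ?_
          rw [majorArc, Real.volume_Icc]
          congr 1; ring
      _ ≤ ∑ a ∈ Finset.Icc 1 q, ENNReal.ofReal (2 / (q * Q)) :=
          Finset.sum_le_sum_of_subset_of_nonneg (Finset.filter_subset _ _) fun _ _ _ => bot_le
      _ = ENNReal.ofReal ((q : ℝ) * (2 / (q * Q))) := by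
          rw [Finset.sum_const, Nat.card_Icc, Nat.add_sub_cancel, nsmul_eq_mul,
            ← ENNReal.ofReal_natCast, ← ENNReal.ofReal_mul (Nat.cast_nonneg _)]
      _ = ENNReal.ofReal (2 / Q) := by
          congr 1; field_simp
  calc volume (⋃ q ∈ Finset.Icc 1 ⌊P⌋₊,
        ⋃ a ∈ (Finset.Icc 1 q).filter (fun a => a.Coprime q), majorArc Q q a)
      ≤ ∑ q ∈ Finset.Icc 1 ⌊P⌋₊,
          volume (⋃ a ∈ (Finset.Icc 1 q).filter (fun a => a.Coprime q), majorArc Q q a) :=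
        measure_biUnion_finset_le _ _
    _ ≤ ∑ q ∈ Finset.Icc 1 ⌊P⌋₊, ENNReal.ofReal (2 / Q) := Finset.sum_le_sum hq_sum
    _ = ENNReal.ofReal ((⌊P⌋₊ : ℝ) * (2 / Q)) := by
        rw [Finset.sum_const, Nat.card_Icc, Nat.add_sub_cancel, nsmul_eq_mul,
          ← ENNReal.ofReal_natCast, ← ENNReal.ofReal_mul (Nat.cast_nonneg _)]
    _ ≤ ENNReal.ofReal (2 * P / Q) := by
        apply ENNReal.ofReal_le_ofReal
        have h1 : (⌊P⌋₊ : ℝ) ≤ P := Nat.floor_le hP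
        have h2 : 0 ≤ 2 / Q := by positivity
        calc (⌊P⌋₊ : ℝ) * (2 / Q) ≤ P * (2 / Q) := mul_le_mul_of_nonneg_right h1 h2
          _ = 2 * P / Q := by ring

end MontgomeryVaughan1975

namespace GoldbachLinnik

/-- **`‖A_N(α) − S(α)‖ ≤ θ(P) + log 2`** for Montgomery–Vaughan's window sum `S = ∑_{P<p≤N}`:
the two sums differ by the primes `2 < p ≤ P` (at most `θ(P)`) and the prime `2` (`log 2`)
(the passage between the frame of Heath-Brown–Puchta, all odd primes, and Montgomery–Vaughan's
window). [cite: MontgomeryVaughanActa1975, §2 (2.2); HeathbrownPuchta2002, §4 (16)] -/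
theorem norm_oddPrimeLogSum_sub_expSum_le (N : ℕ) (P α : ℝ) :
    ‖oddPrimeLogSum N α - MontgomeryVaughan1975.expSum P N α‖ ≤
      Chebyshev.theta P + Real.log 2 := by
  have hsplit := Finset.sum_filter_add_sum_filter_not (Nat.primesLE N) Odd
    (fun p => (Real.log p : ℂ) * (𝐞 ((p : ℝ) * α) : ℂ))
  have hodd : ∑ p ∈ (Nat.primesLE N).filter Odd, (Real.log p : ℂ) * (𝐞 ((p : ℝ) * α) : ℂ) =
      oddPrimeLogSum N α := by rw [oddPrimeLogSum, oddPrimes_eq_filter]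
  have hR : ‖∑ p ∈ (Nat.primesLE N).filter (fun p => ¬ Odd p),
      (Real.log p : ℂ) * (𝐞 ((p : ℝ) * α) : ℂ)‖ ≤ Real.log 2 := by
    refine (norm_sum_le _ _).trans ?_
    have hsub : (Nat.primesLE N).filter (fun p => ¬ Odd p) ⊆ {2} := by
      intro p hp
      rw [mem_filter, Nat.mem_primesLE] at hp
      rw [mem_singleton]
      rcases hp.1.2.eq_two_or_odd' with h | h
      · exact h
      · exact absurd h hp.2
    calc ∑ p ∈ (Nat.primesLE N).filter (fun p => ¬ Odd p),
          ‖(Real.log p : ℂ) * (𝐞 ((p : ℝ) * α) : ℂ)‖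
        ≤ ∑ p ∈ ({2} : Finset ℕ), ‖(Real.log p : ℂ) * (𝐞 ((p : ℝ) * α) : ℂ)‖ :=
          Finset.sum_le_sum_of_subset_of_nonneg hsub fun _ _ _ => norm_nonneg _
      _ = Real.log 2 := by
          rw [sum_singleton, norm_mul, Circle.norm_coe, mul_one, Complex.norm_real,
            Real.norm_of_nonneg (Real.log_nonneg (by norm_num))]
          norm_num
  have heq : oddPrimeLogSum N α = primeExpSumLog N α -
      ∑ p ∈ (Nat.primesLE N).filter (fun p => ¬ Odd p),
        (Real.log p : ℂ) * (𝐞 ((p : ℝ) * α) : ℂ) := by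
    rw [← hodd, primeExpSumLog, ← hsplit]; ring
  have hF : ‖primeExpSumLog N α - MontgomeryVaughan1975.expSum P N α‖ ≤ Chebyshev.theta P := by
    have := MontgomeryVaughan1975.norm_primeExpSumLog_sub_expSum_le P (N : ℝ) α
    rwa [Nat.floor_natCast] at this
  calc ‖oddPrimeLogSum N α - MontgomeryVaughan1975.expSum P N α‖
      = ‖(primeExpSumLog N α - MontgomeryVaughan1975.expSum P N α) -
          ∑ p ∈ (Nat.primesLE N).filter (fun p => ¬ Odd p),
            (Real.log p : ℂ) * (𝐞 ((p : ℝ) * α) : ℂ)‖ := by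
        rw [heq, sub_right_comm]
    _ ≤ ‖primeExpSumLog N α - MontgomeryVaughan1975.expSum P N α‖ +
          ‖∑ p ∈ (Nat.primesLE N).filter (fun p => ¬ Odd p),
            (Real.log p : ℂ) * (𝐞 ((p : ℝ) * α) : ℂ)‖ := norm_sub_le _ _
    _ ≤ Chebyshev.theta P + Real.log 2 := add_le_add hF hR

/-- **`|[0,1] ∩ periodicArcs P Q| ≤ 4P/Q`** (the periodised arcs are `𝔐 ∪ (𝔐 − 1)` and Lebesgue
measure is translation invariant). [cite: PintzRuzsa2003, (2.2)–(2.3)] -/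
theorem volume_real_inter_periodicArcs_le {P Q : ℝ} (hP : 0 ≤ P) (hQ : 0 < Q) :
    volume.real (Set.Icc (0 : ℝ) 1 ∩ periodicArcs P Q) ≤ 4 * P / Q := by
  have hM := MontgomeryVaughan1975.volume_majorArcs_le hP hQ
  have h1 : volume (Set.Icc (0 : ℝ) 1 ∩ periodicArcs P Q) ≤ ENNReal.ofReal (4 * P / Q) := by
    calc volume (Set.Icc (0 : ℝ) 1 ∩ periodicArcs P Q) ≤ volume (periodicArcs P Q) :=
          measure_mono Set.inter_subset_right
      _ ≤ volume (MontgomeryVaughan1975.majorArcs P Q) +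
            volume ((fun α : ℝ => α + 1) ⁻¹' MontgomeryVaughan1975.majorArcs P Q) :=
          measure_union_le _ _
      _ = volume (MontgomeryVaughan1975.majorArcs P Q) +
            volume (MontgomeryVaughan1975.majorArcs P Q) := by
          rw [measure_preimage_add_right]
      _ ≤ ENNReal.ofReal (2 * P / Q) + ENNReal.ofReal (2 * P / Q) := add_le_add hM hM
      _ = ENNReal.ofReal (4 * P / Q) := by
          rw [← ENNReal.ofReal_add (by positivity) (by positivity)]
          congr 1; ring
  calc volume.real (Set.Icc (0 : ℝ) 1 ∩ periodicArcs P Q)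
      = (volume (Set.Icc (0 : ℝ) 1 ∩ periodicArcs P Q)).toReal := rfl
    _ ≤ (ENNReal.ofReal (4 * P / Q)).toReal := ENNReal.toReal_mono ENNReal.ofReal_ne_top h1
    _ = 4 * P / Q := ENNReal.toReal_ofReal (by positivity)

/-- **The log-weighted Goldbach major-arc integral on the periodised arcs against `R₁(n)`**
(θ-form): for `1 ≤ P`, `P + 1 < Q`,
`|R^G_{periodicArcs P Q}(N; n) − Re R₁(n)| ≤ (4P/Q) · ((θ(P) + log 2) · 2θ(N))`,
where `R₁(n) = ∫_{𝔐(P,Q)} S(α)² e(−nα) dα` with the window `P < p ≤ N`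
(de-periodisation `setIntegral_inter_periodicArcs_eq`, then `‖A_N² − S²‖ ≤ ‖A_N − S‖(‖A_N‖ + ‖S‖)`
pointwise on a set of measure `≤ 4P/Q`).
[cite: MontgomeryVaughanActa1975, §3 (3.1); HeathbrownPuchta2002, §4 (20)] -/
theorem abs_majorArcGoldbachIntegral_periodicArcs_sub_re_le (N n : ℕ) {P Q : ℝ} (hP : 1 ≤ P)
    (hPQ : P + 1 < Q) :
    |majorArcGoldbachIntegral (periodicArcs P Q) N n -
        (MontgomeryVaughan1975.majorArcIntegral P Q N n).re| ≤
      4 * P / Q * ((Chebyshev.theta P + Real.log 2) * (2 * Chebyshev.theta N)) := by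
  have hP0 : 0 ≤ P := by linarith
  have hQ0 : 0 < Q := by linarith
  set S' : Set ℝ := Set.Icc (0 : ℝ) 1 ∩ periodicArcs P Q with hS'
  set f : ℝ → ℂ := fun α => oddPrimeLogSum N α ^ 2 * (𝐞 (-(n : ℝ) * α) : ℂ) with hf
  set g : ℝ → ℂ := fun α =>
    MontgomeryVaughan1975.expSum P N α ^ 2 * (𝐞 (-(n * α)) : ℂ) with hg
  have hg_cont : Continuous g := MontgomeryVaughan1975.continuous_expSum_sq_mul P N n
  have hg_per : ∀ x, g (x + 1) = g x := by
    intro x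
    simp only [hg]
    rw [MontgomeryVaughan1975.expSum_add_one]
    have he : (𝐞 (-(n * (x + 1))) : ℂ) = 𝐞 (-(n * x)) := by
      have h1 : (𝐞 (-((n : ℕ) : ℝ)) : ℂ) = 1 := by
        rw [show (-((n : ℕ) : ℝ)) = ((-(n : ℤ) : ℤ) : ℝ) by push_cast; ring,
          Real.fourierChar_apply', Circle.exp_two_pi_mul_int, Circle.coe_one]
      rw [show (-(n * (x + 1)) : ℝ) = -(n * x) + -(n : ℝ) by ring, fourierChar_add_coe, h1,
        mul_one]
    rw [he]
  have hf_cont : Continuous f := by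
    simp only [hf]
    exact ((continuous_oddPrimeLogSum N).pow 2).mul (continuous_fourierChar_mul _)
  -- the two integrals over `S'`
  have hR₁ : MontgomeryVaughan1975.majorArcIntegral P Q N n = ∫ α in S', g α := by
    rw [MontgomeryVaughan1975.majorArcIntegral, hS', setIntegral_inter_periodicArcs_eq hg_cont hg_per hP hPQ]
  have hRG : majorArcGoldbachIntegral (periodicArcs P Q) N n = (∫ α in S', f α).re := rfl
  -- integrability on `S' ⊆ [0,1]`
  have hS'sub : S' ⊆ Set.Icc (0 : ℝ) 1 := Set.inter_subset_left
  have hS'vol : volume S' < ⊤ :=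
    lt_of_le_of_lt (measure_mono hS'sub) (by rw [Real.volume_Icc]; exact ENNReal.ofReal_lt_top)
  have hfi : IntegrableOn f S' := (hf_cont.integrableOn_Icc).mono_set hS'sub
  have hgi : IntegrableOn g S' := (hg_cont.integrableOn_Icc).mono_set hS'sub
  have hdiff : (∫ α in S', f α) - (∫ α in S', g α) = ∫ α in S', (f α - g α) :=
    (integral_sub hfi hgi).symm
  -- pointwise bound
  set C : ℝ := (Chebyshev.theta P + Real.log 2) * (2 * Chebyshev.theta N) with hC
  have hpt : ∀ α ∈ S', ‖f α - g α‖ ≤ C := by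
    intro α _
    have he : (𝐞 (-(n : ℝ) * α) : ℂ) = 𝐞 (-(n * α)) := by rw [neg_mul]
    have hfg : f α - g α =
        (oddPrimeLogSum N α - MontgomeryVaughan1975.expSum P N α) *
          (oddPrimeLogSum N α + MontgomeryVaughan1975.expSum P N α) * (𝐞 (-(n * α)) : ℂ) := by
      simp only [hf, hg]; rw [he]; ring
    rw [hfg, norm_mul, norm_mul, Circle.norm_coe, mul_one]
    have h1 := norm_oddPrimeLogSum_sub_expSum_le N P α
    have h2 : ‖oddPrimeLogSum N α + MontgomeryVaughan1975.expSum P N α‖ ≤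
        2 * Chebyshev.theta N := by
      calc ‖oddPrimeLogSum N α + MontgomeryVaughan1975.expSum P N α‖
          ≤ ‖oddPrimeLogSum N α‖ + ‖MontgomeryVaughan1975.expSum P N α‖ := norm_add_le _ _
        _ ≤ Chebyshev.theta N + Chebyshev.theta N :=
            add_le_add (norm_oddPrimeLogSum_le_theta N α)
              (MontgomeryVaughan1975.norm_expSum_le_theta P N α)
        _ = 2 * Chebyshev.theta N := by ring
    have h10 : 0 ≤ Chebyshev.theta P + Real.log 2 :=
      add_nonneg (Chebyshev.theta_nonneg P) (Real.log_nonneg (by norm_num))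
    rw [hC]
    exact mul_le_mul h1 h2 (norm_nonneg _) h10
  have hint : ‖∫ α in S', (f α - g α)‖ ≤ C * volume.real S' :=
    norm_setIntegral_le_of_norm_le_const hS'vol hpt
  have hC0 : 0 ≤ C := by
    rw [hC]
    exact mul_nonneg (add_nonneg (Chebyshev.theta_nonneg P) (Real.log_nonneg (by norm_num)))
      (mul_nonneg zero_le_two (Chebyshev.theta_nonneg _))
  have hvol := volume_real_inter_periodicArcs_le hP0 hQ0
  rw [hRG, hR₁, ← Complex.sub_re]
  calc |((∫ α in S', f α) - ∫ α in S', g α).re| ≤ ‖(∫ α in S', f α) - ∫ α in S', g α‖ :=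
        Complex.abs_re_le_norm _
    _ = ‖∫ α in S', (f α - g α)‖ := by rw [hdiff]
    _ ≤ C * volume.real S' := hint
    _ ≤ C * (4 * P / Q) := mul_le_mul_of_nonneg_left hvol hC0
    _ = 4 * P / Q * C := mul_comm _ _

/-- **The same with Chebyshev's bound inserted**: for `1 ≤ P`, `P + 1 < Q`,
`|R^G_{periodicArcs P Q}(N; n) − Re R₁(n)| ≤ 48 P² N / Q`
(`θ(P) + log 2 ≤ (log 4) P + log 2 ≤ 3P`, `2θ(N) ≤ 2(log 4) N ≤ 4N`).  At the Montgomery–Vaughan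
level `P = N^{6δ}`, `Q = N^{1−6δ}` this is `48 N^{18δ}`.
[cite: MontgomeryVaughanActa1975, §3 (3.1); HeathbrownPuchta2002, §4 (20)] -/
theorem abs_majorArcGoldbachIntegral_periodicArcs_sub_re_le' (N n : ℕ) {P Q : ℝ} (hP : 1 ≤ P)
    (hPQ : P + 1 < Q) :
    |majorArcGoldbachIntegral (periodicArcs P Q) N n -
        (MontgomeryVaughan1975.majorArcIntegral P Q N n).re| ≤ 48 * P ^ 2 * N / Q := by
  have h := abs_majorArcGoldbachIntegral_periodicArcs_sub_re_le N n hP hPQ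
  have hQ0 : 0 < Q := by linarith
  have hlog2 : Real.log 2 < 1 := by have := Real.log_two_lt_d9; linarith
  have hlog4 : Real.log 4 < 2 := by
    have : Real.log 4 = 2 * Real.log 2 := by
      rw [show (4 : ℝ) = 2 ^ 2 by norm_num, Real.log_pow]; ring
    rw [this]; linarith
  have hθP : Chebyshev.theta P + Real.log 2 ≤ 3 * P := by
    have := Chebyshev.theta_le_log4_mul_x (show (0 : ℝ) ≤ P by linarith)
    nlinarith
  have hθN : 2 * Chebyshev.theta N ≤ 4 * N := by
    have := Chebyshev.theta_le_log4_mul_x (Nat.cast_nonneg N)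
    nlinarith [Nat.cast_nonneg (α := ℝ) N]
  have h1 : (Chebyshev.theta P + Real.log 2) * (2 * Chebyshev.theta N) ≤ 3 * P * (4 * N) :=
    mul_le_mul hθP hθN (mul_nonneg zero_le_two (Chebyshev.theta_nonneg _)) (by linarith)
  have h2 : 0 ≤ 4 * P / Q := by positivity
  calc |majorArcGoldbachIntegral (periodicArcs P Q) N n -
          (MontgomeryVaughan1975.majorArcIntegral P Q N n).re|
      ≤ 4 * P / Q * ((Chebyshev.theta P + Real.log 2) * (2 * Chebyshev.theta N)) := h
    _ ≤ 4 * P / Q * (3 * P * (4 * N)) := mul_le_mul_of_nonneg_left h1 h2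
    _ = 48 * P ^ 2 * N / Q := by ring

end GoldbachLinnik

end Literature.NumberTheory.Sieve

end
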